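import Summits.BirchSwinnertonDyer.Rank1Residual.Additive.X3BranchKummerLayerTwistedInertia
import Summits.BirchSwinnertonDyer.Rank1Residual.Additive.X3BranchKummerLayerTwistedLocal
import Summits.BirchSwinnertonDyer.Rank1Residual.Additive.X3BranchLayerAddCharClasses
import Summits.BirchSwinnertonDyer.Rank1Residual.Iwasawa.CyclotomicLayerOneCubic
import HarnessLib

/-!
# X3, the DEGENERATE rows OFF the sub-locus: ONE T-SIDE CLASS OVER THE FIRST LAYER in
# `H¹(ℚ_Σ/ℚ_∞, Φ₀)` from integer data (cell `bsd-eis`, seat `bsd-eis-x3` gen 7; assembly of the bricks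
# `X3BranchKummerLayerTwisted*.lean` and `X3BranchLayerAddCharClasses.lean` (MEMO-9 §2.4 (f));
# route K1 `AdditiveBranchIMC`, crux `GordTwoRankZeroOffCaseOne` — supports only)

HONEST FRAMING (`run/shared/lean/pub/bsd-eis/README.md` §4): THEOREMS ONLY (no `def`, no named fact,
no `sorry`); nothing is booked; no label, tier or count of record moves.

## What

For the cyclotomic `κ : ZpExtension ℚ 3`, a trivial rational line `Φ₀ ≤ W[3]`, a primitive `9`-th
root of unity `ζ` and INTEGER POLYNOMIALS `B, B', E` with
`B(ζ)·B'(ζ) = n ∈ ℕ₊` (support of the radicand), `B(ζ⁸)·B(ζ) = E(ζ + ζ⁸)³` (the twisted condition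
`c(b)·b = e³`, `e ∈ ℚ_1`), every prime `v ∋ n` in `S₀`, and a cube root `β` of `b = B(ζ)`:
`exists_layerTClass_mem_residualLineH1` produces a class of `H¹(ℚ_Σ/ℚ_∞, Φ₀)` (`residualLineH1`,
unramified outside `S₀ ∪ {3}`) whose cocycle on `G_{ℚ_∞}` is `h ↦ χ(h)·x₀` for the twisted Kummer
character `χ` of `β` on the layer group `G₁ = κ⁻¹(3ℤ₃)` — with `χ`'s additivity on `G₁` and its explicit
values on both cosets of `Stab(ζ₃)` recorded for the independence step (the successor's file).
For the T-side data of the `needs_T_layer1` rows: `B = ϖ_j c(ϖ_j)²`, `B' = ℓ³/B`, `E = π_j`, `n = ℓ³`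
(`x3-g7-gen/tside-data-j276658.txt`).
References: [GreenbergVatsal2000] §2 pp. 26–30; [SerreLocalFields1979] Ch. X §3; [Washington1997] §2,
Prop. 2.3.
-/

set_option autoImplicit false

noncomputable section

open scoped Classical AddSubgroup

namespace Summit.BirchSwinnertonDyer.Rank1Residual.Additive

namespace KummerLayerTwisted

open Field Polynomial NumberField IsDedekindDomain WeierstrassCurve
  Literature.NumberTheory.GaloisRepresentations
  Literature.NumberTheory.EllipticCurves
  Literature.NumberTheory.EllipticCurves.GreenbergSelmer
  Literature.NumberTheory.EllipticCurves.GreenbergVatsal2000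
  Literature.NumberTheory.EllipticCurves.Rank1Residual
  Summit.BirchSwinnertonDyer.Rank1Residual.Iwasawa.CyclotomicLayerOne
  TrivialLineClasses

variable {W : WeierstrassCurve ℚ}

/-- **One T-side class over the first layer.** See the module docstring. Output: the twisted Kummer
character `χ : Γ_ℚ → ℤ/3` of `β` (`β³ = B(ζ)`) on `G₁ = κ.layerSubgroup 1` — additive on `G₁`, with
`σβ = ζ₃^m β, χσ = m` on `G₁ ∩ Stab(ζ₃)` and `σβ = ζ₃^m E(θ) β⁻¹, χσ = −m` off it (`ζ₃ = ζ³`,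
`θ = ζ + ζ⁸`) — and a class `c ∈ H¹(ℚ_Σ/ℚ_∞, Φ₀)` whose cocycle is `h ↦ (χ h).val • x₀`.
[cite: GreenbergVatsal2000, §2 pp. 28–30] [cite: SerreLocalFields1979, Ch. X §3] -/
theorem exists_layerTClass_mem_residualLineH1 [hp : Fact (Nat.Prime 3)]
    (κ : ZpExtension ℚ 3) (hκ : κ.IsCyclotomic) (S₀ : Finset (HeightOneSpectrum (𝓞 ℚ)))
    {Φ₀ : AddSubgroup (W.geomTorsion ((3 : ℕ) : ℤ))} (hΦ : IsRationalLine W 3 Φ₀)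
    (htriv : ∀ (σ : absoluteGaloisGroup ℚ) (Pt : geomTorsion W ((3 : ℕ) : ℤ)), Pt ∈ Φ₀ → σ • Pt = Pt)
    (x₀ : (residualLine Φ₀ hΦ).Sub) (hx₀ : 3 • x₀ = 0)
    {ζ : AlgebraicClosure ℚ} (hζ : IsPrimitiveRoot ζ 9)
    (B B' E : ℤ[X]) {n : ℕ} (hn0 : n ≠ 0)
    (hn : aeval ζ B * aeval ζ B' = (n : AlgebraicClosure ℚ))
    (hnS : ∀ v : HeightOneSpectrum (𝓞 ℚ), ((n : ℕ) : 𝓞 ℚ) ∈ v.asIdeal → v ∈ S₀)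
    (hflip : aeval (ζ ^ 8) B * aeval ζ B = aeval (ζ + ζ ^ 8) E ^ 3)
    {β : AlgebraicClosure ℚ} (hβ : β ^ 3 = aeval ζ B) :
    ∃ (χ : absoluteGaloisGroup ℚ → ZMod 3)
      (c : subgroupH1 κ.kerSubgroup (residualLine Φ₀ hΦ).Sub),
      c ∈ residualLineH1 W 3 κ S₀ Φ₀ hΦ ∧
      (∀ h : κ.kerSubgroup, (cocycleOf κ.kerSubgroup (residualLine Φ₀ hΦ).Sub
        (subgroup_smul_eq_self_of_trivial κ.kerSubgroup (residualLine_smul_eq_self hΦ htriv)) c).1 h =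
        (χ h).val • x₀) ∧
      (∀ σ ∈ κ.layerSubgroup 1, ∀ τ ∈ κ.layerSubgroup 1, χ (σ * τ) = χ σ + χ τ) ∧
      (∀ σ ∈ κ.layerSubgroup 1, σ • ζ ^ 3 = ζ ^ 3 →
        ∃ m : ℕ, σ • β = (ζ ^ 3) ^ m * β ∧ χ σ = m) ∧
      (∀ σ ∈ κ.layerSubgroup 1, σ • ζ ^ 3 ≠ ζ ^ 3 →
        ∃ m : ℕ, σ • β = (ζ ^ 3) ^ m * aeval (ζ + ζ ^ 8) E * β⁻¹ ∧ χ σ = -(m : ZMod 3)) := by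
  have htrivΦ := residualLine_smul_eq_self hΦ htriv
  have hHG : κ.kerSubgroup ≤ κ.layerSubgroup 1 := κ.kerSubgroup_le_layerSubgroup 1
  have hζ₃ : IsPrimitiveRoot (ζ ^ 3) 3 := isPrimitiveRoot_zeta9_cube hζ
  -- `θ = ζ + ζ⁸` is fixed by the layer group `G₁`
  have hG1θ : ∀ σ ∈ κ.layerSubgroup 1, σ • (ζ + ζ ^ 8) = ζ + ζ ^ 8 := by
    intro σ hσ
    have hmem := zeta_add_pow_mem_layer_one hκ ζ hζ.pow_eq_one
    rw [ZpExtension.layer, IntermediateField.mem_fixedField_iff] at hmem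
    exact hmem _ (Subgroup.mem_map.mpr ⟨σ, hσ, rfl⟩)
  -- the radicand `b = B(ζ)` and `e = E(θ)`
  have hb0 : aeval ζ B ≠ 0 := by
    intro h0
    rw [h0, zero_mul, eq_comm, Nat.cast_eq_zero] at hn
    exact hn0 hn
  have heG : ∀ σ ∈ κ.layerSubgroup 1, σ • aeval (ζ + ζ ^ 8) E = aeval (ζ + ζ ^ 8) E := fun σ hσ ↦ by
    rw [smul_aeval_eq, hG1θ σ hσ]
  have hfix : ∀ σ ∈ κ.layerSubgroup 1, σ • ζ ^ 3 = ζ ^ 3 → σ • aeval ζ B = aeval ζ B :=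
    fun σ hσ h3 ↦ smul_aeval_zeta9_eq_self hζ B (hG1θ σ hσ) h3
  have hflip' : ∀ σ ∈ κ.layerSubgroup 1, σ • ζ ^ 3 ≠ ζ ^ 3 →
      σ • aeval ζ B * aeval ζ B = aeval (ζ + ζ ^ 8) E ^ 3 := fun σ hσ h3 ↦ by
    rw [smul_aeval_zeta9_eq_aeval_pow_eight hζ B (hG1θ σ hσ) h3, hflip]
  -- the twisted Kummer character on `G₁`
  obtain ⟨χ, hχlc, hχadd, hχ₁, hχ₂⟩ :=
    exists_twistedKummerChar (κ.layerSubgroup 1) hζ₃ hb0 hβ heG hfix hflip'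
  -- its push to the trivial line: `χ' g = (χ g).val • x₀`
  set χ' : absoluteGaloisGroup ℚ → (residualLine Φ₀ hΦ).Sub := fun g ↦ (χ g).val • x₀ with hχ'def
  have hχ'add : ∀ a ∈ κ.layerSubgroup 1, ∀ b ∈ κ.layerSubgroup 1, χ' (a * b) = χ' a + χ' b := by
    intro a ha b hb
    simp only [hχ'def, hχadd a ha b hb, ZMod.val_add, ← nsmul_eq_mod_nsmul _ hx₀, add_nsmul]
  have hχ'cont : Continuous χ' := (hχlc.comp fun z : ZMod 3 ↦ z.val • x₀).continuous
  obtain ⟨c, hc⟩ := LayerAddChar.exists_class_of_addCharOn κ.kerSubgroup htrivΦ hHG χ' hχ'add hχ'cont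
  have hβ0 : β ≠ 0 := by
    rintro rfl
    exact hb0 (by rw [← hβ]; norm_num)
  refine ⟨χ, c, ?_, hc, hχadd, hχ₁, hχ₂⟩
  -- membership in `H¹(ℚ_Σ/ℚ_∞, Φ₀)`: unramified at every `v ∉ S₀ ∪ {3}`
  change c ∈ unramifiedOutside κ.kerSubgroup (residualLine Φ₀ hΦ).Sub 3
    (↑S₀ : Set (HeightOneSpectrum (𝓞 ℚ)))
  refine LayerAddChar.mem_unramifiedOutside_of_addCharOn κ.kerSubgroup htrivΦ hHG χ' hχ'add hχ'cont
    c hc 3 _ fun v hvS h3v σ τ hτ ↦ ?_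
  have hnv : ((n : ℕ) : 𝓞 ℚ) ∉ v.asIdeal := fun h ↦ hvS (hnS v h)
  have hτker : τ ∈ κ.kerSubgroup :=
    X2.GreenbergVatsalUnramifiedAway.inertia_le_kerSubgroup_of_isCyclotomic κ v hκ h3v hτ
  have hval : χ (σ⁻¹ * τ * σ) = 0 :=
    twistedChar_conj_eq_zero hζ₃ hβ0 hχ₁
      (by rw [smul_pow', inertia_smul_zeta9 hζ h3v hτ]) σ
      (inertia_smul_conj_radical hζ B B' hn hβ h3v hnv hτ σ)
      (by
        have h := (κ.layerSubgroup_normal 1).conj_mem τ (hHG hτker) σ⁻¹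
        simpa using h)
  simp only [hχ'def, hval, ZMod.val_zero, zero_nsmul]

end KummerLayerTwisted

end Summit.BirchSwinnertonDyer.Rank1Residual.Additive

end
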